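import Summits.QuantumFields.BalabanUV.T4Continuum.Support.NE7CurlRemainderGradient
import Summits.QuantumFields.BalabanUV.T4Continuum.Support.NE3CurlReverseReading
import HarnessLib

/-!
# NE7CurlGradientReading — socket `h′` SUPPLIER LINE, STUB (S-b) CLOSED (ROAD-G106 §4): THE COVARIANT GRADIENT OF THE DRESSED CURL OF THE RELATIVE
# COORDINATE IS READ OFF THE PLAQUETTE-GRADIENT RADII OF THE TWO CONFIGURATIONS — for `U′ = W·e^{X}` (`W` unitary, `X` skew, `‖X‖ ≤ α ≤ 1∕48`,
# covariant gradient letter `α₁`, plaquette radii `x_W, x_U` and plaquette-GRADIENT radii `x₁W, x₁U` at `(p, λ)`):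
# `‖Ad_{W(z,λ)} (d_W X)(p + e_λ) − (d_W X)(p)‖ ≤ 2x₁U + 3x₁W + 8α·x_U + 128α·α₁ + 2048α²(x_W + x_U) + 1330α³`
# — the datum `B′ = O(εξ³)` of the C¹ slice letter (S-d), every term at the rate `ξ³` in the tree's currency (§4)

Cell `pub-balaban`, rung (B)+1 sub-cell t4, lineage `b2b-balaban-t4-ne7-p1`, generation 107 (CRUX PROVER NE7 #1 = OWNER of BINDER row NE7).
Memo `t4/b2b-balaban-t4-ne7-p1-g106/ROAD-G106.md` §4 (S-b), §6; sequel memo `…-g107/ROAD-G107.md` §1.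
WHY.  The supplier line for the open Lipschitz∕Hölder conjuncts (Lip₁ᶜ)(Höl½ᶜ) of the amended socket `h′` (`NE7EtaClosenessHolder`) runs a C¹ sup-norm slice
theory for the relative coordinate `X` of the minimiser pair (`U_A^{u} = W e^{X}`, `W = cavg U_B`); its data are the dressed curl `d_W X` (zeroth order:
`NE3CurlReverseReading.norm_curl_le_of_radii`, `O(εξ²)`) and ONE LATTICE DERIVATIVE of it — THIS FILE: assembled from (S-b)₁ (`NE7PlaquetteQuotientGradient`:
the quotient `D = U′(∂p)W(∂p)⁻¹ − 1` is Lipschitz with the plaquette-gradient radii), the Grönwall brick (`NE7SegmentPlaquetteGradient`), the moving-curl brick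
(`NE7MovingCurlGradient`) and the remainder brick (`NE7CurlRemainderGradient`: `E₂` is Lipschitz, raw absorbed reading).
WHAT ([folklore]; 0 def, 0 sorry; any dimension, any `U(n)`).
 * §1 `exp_sub_one_le_two_mul` (`e^α − 1 ≤ 2α` on `[0, 1∕2]`), `exp_four_mul_le_two` (`e^{4α} ≤ 2` for `α ≤ 1∕8`).
 * §2 **`norm_curl_covDiff_le_letters`** — the raw reading with every letter explicit: `Q₁` (moving cubic vertex), `Γ` (moving curl), `G` (plaquette-gradient
   radius along the segment, Grönwall), in terms of `α`, `α₁`, the segment's small-field radius `x`, and `x₁ = ‖Ad_{W(z,λ)}W(∂p′) − W(∂p)‖`.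
 * §3 **`norm_curl_covDiff_le_poly`** — `α ≤ 1∕48`: `‖∇c‖ ≤ 2‖∇D‖ + 128αα₁ + 48αx₁ + 2048α²x + 1024α³` (the `O(α)‖∇c‖` terms absorbed).
 * §4 **`norm_curlGrad_le_of_radii`** (headline) and **`norm_curlGrad_le_scaled`** — the tree's currency `ξ = (L^k)⁻¹ ≤ 1`: `x₁U ≤ 2c_Aξ³`, `x₁W ≤ 2c_Wξ³`,
   `x_U, x_W ≤ bξ²`, `α ≤ C_Sε·ξ` (`C_Sε ≤ 1∕48`), `α₁ ≤ a₁ξ²` ⟹ `‖∇_W(d_W X)‖ ≤ (4c_A + 6c_W + C_Sε(8b + 128a₁ + 4096C_Sε·b + 1330C_Sε²))·ξ³`.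
HONEST FRAMING (page 1): lattice kinematics on OUR objects; the radii and the gradient letter `α₁` are HYPOTHESES (printed TYPE [Balaban1985Variational] Thm 1 (10)
for the radii; `α₁` is the bootstrap quantity of (S-d)); nothing of Bałaban's asserted as an axiom; (S-c)(S-d)(S-f)(S-g) of the supplier line remain; nothing of
NE3∕NE7 discharged; spine count = dagwriter∕referees' call; FIXED FINITE T⁴, rung (B)+1 — NOT infinite volume, NOT mass gap, NOT BetaPertH, NOT Clay.
-/

set_option autoImplicit false

open scoped BigOperators Matrix Matrix.Norms.L2Operator
open Finset NormedSpace Set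

namespace Summit.QuantumFields.BalabanUV.T4Continuum.NE7CurlGradientReading

open Literature.MathematicalPhysics.QuantumFieldTheory.Balaban1983to89
open B7Prop1Explicit B7Prop2Explicit
open T4AveragingDeficitWall hiding Site Plane Plaq Bond
open AveragingDeficitPlaqDeriv (vary_isUnitaryCfg)
open NE3CurlReverseReading (one_sub_mul_exp_le_one)
open NE7SegmentPlaquetteRadius (smallField_vary_segment_max)
open NE7SegmentPlaquetteGradient (norm_transPlaq_vary_le)
open NE7PlaquetteQuotientGradient (norm_plaqQuot_covDiff_le)
open NE7MovingCurlGradient (norm_movingCurl_covDiff_Q₁)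
open NE7CurlRemainderGradient (norm_transPlaqW_le norm_curl_covDiff_le_abstract)

noncomputable section

variable {d : ℕ} {n : Type*} [Fintype n] [DecidableEq n]

/-! ## §1 Two scalar facts -/

omit [Fintype n] [DecidableEq n] in
/-- `e^α − 1 ≤ 2α` for `0 ≤ α ≤ 1∕2` (`e^α − 1 ≤ αe^α`, `e^{1∕2} ≤ 2`). [folklore] -/
theorem exp_sub_one_le_two_mul {α : ℝ} (h0 : 0 ≤ α) (h1 : α ≤ 1 / 2) : Real.exp α - 1 ≤ 2 * α := by
  have hhalf : Real.exp (1 / 2 : ℝ) ≤ 2 := by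
    have := one_sub_mul_exp_le_one (1 / 2 : ℝ); linarith
  have hle : Real.exp α ≤ 2 := (Real.exp_le_exp.mpr h1).trans hhalf
  have h2 := one_sub_mul_exp_le_one α
  nlinarith [Real.exp_pos α]

omit [Fintype n] [DecidableEq n] in
/-- `e^{4α} ≤ 2` for `α ≤ 1∕8`. [folklore] -/
theorem exp_four_mul_le_two {α : ℝ} (h1 : α ≤ 1 / 8) : Real.exp (4 * α) ≤ 2 := by
  have hhalf : Real.exp (1 / 2 : ℝ) ≤ 2 := by
    have := one_sub_mul_exp_le_one (1 / 2 : ℝ); linarith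
  exact (Real.exp_le_exp.mpr (by linarith)).trans hhalf

/-! ## §2 The raw reading with explicit letters -/

/-- **THE RAW READING OF THE CURL'S GRADIENT, LETTERS EXPLICIT.**  `W` unitary, `X` skew, `‖X‖ ≤ α`, forward covariant gradient letter
`‖Ad_{W(y+e_κ,τ)}X(y+e_τ,κ) − X(y,κ)‖ ≤ α₁`; the segment `V_s = We^{sX}` stays small-field with radius `x ≥ 0`; `μ ≠ ν`; `x₁ ≥ ‖Ad_{W(z,λ)}W(∂p′) − W(∂p)‖`.
With `ε₁ = e^α − 1`, `Q₁ = 64α(α₁ + 2ε₁α) + 960xα² + 64ε₁α²`, `Γ = ‖∇c‖ + Q₁ + 8αε₁`, `G = (x₁ + 2αx + Γ)e^{4α} + 2ε₁x` (`∇c = Ad_{W(z,λ)}(d_W X)(p′) − (d_W X)(p)`):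
`‖∇c‖ ≤ ‖Ad_{W(z,λ)}D(p′) − D(p)‖ + (Q₁ + 24αε₁G + ‖∇c‖(4α + 24αε₁) + 4α(G + x₁)) + (8α + 24αε₁)x₁`. [folklore] -/
theorem norm_curl_covDiff_le_letters [Nonempty n] {W : Site d → Fin d → (Matrix n n ℂ)ˣ} (hW : IsUnitaryCfg W)
    {X : Site d → Fin d → Matrix n n ℂ} (hX : IsSkewDir X) {α α₁ x x₁ : ℝ} (hXα : ∀ x κ, ‖X x κ‖ ≤ α)
    (hX1 : ∀ (y : Site d) (κ τ : Fin d), ‖Ad (W (y + e κ) τ) (X (y + e τ) κ) - X y κ‖ ≤ α₁) (hx : 0 ≤ x)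
    (hxs : ∀ s ∈ Icc (0 : ℝ) 1, SmallField (vary W X s) x) (z : Site d) (lam : Fin d) {μ ν : Fin d} (hμν : μ ≠ ν)
    (hx₁ : ‖Ad (W z lam) ((hol W (z + e lam) (plaqWord μ ν) : (Matrix n n ℂ)ˣ) : Matrix n n ℂ) - ((hol W z (plaqWord μ ν) : (Matrix n n ℂ)ˣ) : Matrix n n ℂ)‖ ≤ x₁) :
    ‖Ad (W z lam) (curlAt W X (z + e lam) μ ν) - curlAt W X z μ ν‖
      ≤ ‖Ad (W z lam) (((hol (vary W X 1) (z + e lam) (plaqWord μ ν) * (hol W (z + e lam) (plaqWord μ ν))⁻¹ : (Matrix n n ℂ)ˣ) : Matrix n n ℂ) - 1)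
            - ((((hol (vary W X 1) z (plaqWord μ ν) * (hol W z (plaqWord μ ν))⁻¹ : (Matrix n n ℂ)ˣ) : Matrix n n ℂ)) - 1)‖
        + ((64 * α * (α₁ + 2 * (Real.exp α - 1) * α) + 960 * x * α ^ 2 + 64 * (Real.exp α - 1) * α ^ 2)
            + 24 * α * (Real.exp α - 1)
              * ((x₁ + 2 * α * x + (‖Ad (W z lam) (curlAt W X (z + e lam) μ ν) - curlAt W X z μ ν‖
                  + (64 * α * (α₁ + 2 * (Real.exp α - 1) * α) + 960 * x * α ^ 2 + 64 * (Real.exp α - 1) * α ^ 2)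
                  + 8 * α * (Real.exp α - 1))) * Real.exp (4 * α) + 2 * (Real.exp α - 1) * x)
            + ‖Ad (W z lam) (curlAt W X (z + e lam) μ ν) - curlAt W X z μ ν‖ * (4 * α + 24 * α * (Real.exp α - 1))
            + 4 * α * (((x₁ + 2 * α * x + (‖Ad (W z lam) (curlAt W X (z + e lam) μ ν) - curlAt W X z μ ν‖
                  + (64 * α * (α₁ + 2 * (Real.exp α - 1) * α) + 960 * x * α ^ 2 + 64 * (Real.exp α - 1) * α ^ 2)
                  + 8 * α * (Real.exp α - 1))) * Real.exp (4 * α) + 2 * (Real.exp α - 1) * x) + x₁))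
        + (8 * α + 24 * α * (Real.exp α - 1)) * x₁ := by
  -- letters
  set y : ℝ := ‖Ad (W z lam) (curlAt W X (z + e lam) μ ν) - curlAt W X z μ ν‖ with hy
  set ε₁ : ℝ := Real.exp α - 1 with hε₁
  set Q₁ : ℝ := 64 * α * (α₁ + 2 * ε₁ * α) + 960 * x * α ^ 2 + 64 * ε₁ * α ^ 2 with hQ₁
  set Γ : ℝ := y + Q₁ + 8 * α * ε₁ with hΓ
  set G : ℝ := (x₁ + 2 * α * x + Γ) * Real.exp (4 * α) + 2 * ε₁ * x with hG
  have hα0 : 0 ≤ α := (norm_nonneg _).trans (hXα z lam)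
  have hα₁0 : 0 ≤ α₁ := (norm_nonneg _).trans (hX1 z lam lam)
  have hε₁0 : 0 ≤ ε₁ := by rw [hε₁]; linarith [Real.add_one_le_exp α]
  have hx₁0 : 0 ≤ x₁ := (norm_nonneg _).trans hx₁
  have hy0 : 0 ≤ y := norm_nonneg _
  have hQ₁0 : 0 ≤ Q₁ := by rw [hQ₁]; positivity
  have hΓ0 : 0 ≤ Γ := by rw [hΓ]; positivity
  -- the moving-curl brick: `Q := Q₁` and `Γ`
  have hQ : ∀ t ∈ Icc (0 : ℝ) 1, ‖(Ad (W z lam) (curlAt (vary W X t) X (z + e lam) μ ν) - curlAt (vary W X t) X z μ ν)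
      - (Ad (W z lam) (curlAt W X (z + e lam) μ ν) - curlAt W X z μ ν)‖ ≤ Q₁ := by
    intro t ht
    have h := (norm_movingCurl_covDiff_Q₁ hW hX hXα hX1 hx hxs z lam μ ν ht).1
    exact h.trans (by nlinarith [ht.1, ht.2])
  have hΓs : ∀ s ∈ Icc (0 : ℝ) 1, ‖Ad (vary W X s z lam) (curlAt (vary W X s) X (z + e lam) μ ν) - curlAt (vary W X s) X z μ ν‖ ≤ Γ :=
    fun s hs => (norm_movingCurl_covDiff_Q₁ hW hX hXα hX1 hx hxs z lam μ ν hs).2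
  -- the plaquette radius along the segment at `p′`
  have hxs' : ∀ s ∈ Icc (0 : ℝ) 1, ‖((hol (vary W X s) (z + e lam) (plaqWord μ ν) : (Matrix n n ℂ)ˣ) : Matrix n n ℂ) - 1‖ ≤ x :=
    fun s hs => hxs s hs (z + e lam) μ ν hμν
  -- the Grönwall brick and the transport change: `G`
  have hGs : ∀ t ∈ Icc (0 : ℝ) 1, ‖Ad (W z lam) ((hol (vary W X t) (z + e lam) (plaqWord μ ν) : (Matrix n n ℂ)ˣ) : Matrix n n ℂ)
      - ((hol (vary W X t) z (plaqWord μ ν) : (Matrix n n ℂ)ˣ) : Matrix n n ℂ)‖ ≤ G := by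
    intro t ht
    have h1 := norm_transPlaqW_le hW hX hXα z lam μ ν ht (hxs' t ht)
    have h2 := norm_transPlaq_vary_le hW hX hXα z lam μ ν hx hΓ0 hxs' hΓs hx₁ ht
    rw [hG]; linarith
  -- the abstract reading
  have h := norm_curl_covDiff_le_abstract hW hX hXα z lam μ ν hQ hGs hx₁
  exact h

/-! ## §3 The polynomial form (the `O(α)·‖∇c‖` terms absorbed) -/
set_option maxHeartbeats 400000 in
/-- **THE CURL'S GRADIENT, POLYNOMIAL FORM** (`α ≤ 1∕48`): under the hypotheses of §2,
`‖Ad_{W(z,λ)}(d_W X)(p′) − (d_W X)(p)‖ ≤ 2‖Ad_{W(z,λ)}D(p′) − D(p)‖ + 128αα₁ + 48αx₁ + 2048α²x + 1024α³`. [folklore] -/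
theorem norm_curl_covDiff_le_poly [Nonempty n] {W : Site d → Fin d → (Matrix n n ℂ)ˣ} (hW : IsUnitaryCfg W)
    {X : Site d → Fin d → Matrix n n ℂ} (hX : IsSkewDir X) {α α₁ x x₁ : ℝ} (hXα : ∀ x κ, ‖X x κ‖ ≤ α) (hα : α ≤ 1 / 48)
    (hX1 : ∀ (y : Site d) (κ τ : Fin d), ‖Ad (W (y + e κ) τ) (X (y + e τ) κ) - X y κ‖ ≤ α₁) (hx : 0 ≤ x)
    (hxs : ∀ s ∈ Icc (0 : ℝ) 1, SmallField (vary W X s) x) (z : Site d) (lam : Fin d) {μ ν : Fin d} (hμν : μ ≠ ν)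
    (hx₁ : ‖Ad (W z lam) ((hol W (z + e lam) (plaqWord μ ν) : (Matrix n n ℂ)ˣ) : Matrix n n ℂ) - ((hol W z (plaqWord μ ν) : (Matrix n n ℂ)ˣ) : Matrix n n ℂ)‖ ≤ x₁) :
    ‖Ad (W z lam) (curlAt W X (z + e lam) μ ν) - curlAt W X z μ ν‖
      ≤ 2 * ‖Ad (W z lam) (((hol (vary W X 1) (z + e lam) (plaqWord μ ν) * (hol W (z + e lam) (plaqWord μ ν))⁻¹ : (Matrix n n ℂ)ˣ) : Matrix n n ℂ) - 1)
            - ((((hol (vary W X 1) z (plaqWord μ ν) * (hol W z (plaqWord μ ν))⁻¹ : (Matrix n n ℂ)ˣ) : Matrix n n ℂ)) - 1)‖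
        + 128 * α * α₁ + 48 * α * x₁ + 2048 * α ^ 2 * x + 1024 * α ^ 3 := by
  have hmain := norm_curl_covDiff_le_letters hW hX hXα hX1 hx hxs z lam hμν hx₁
  have hα0 : 0 ≤ α := (norm_nonneg _).trans (hXα z lam)
  have hα₁0 : 0 ≤ α₁ := (norm_nonneg _).trans (hX1 z lam lam)
  have hx₁0 : 0 ≤ x₁ := (norm_nonneg _).trans hx₁
  -- letters (values cleared: only the defining equations are kept)
  set y : ℝ := ‖Ad (W z lam) (curlAt W X (z + e lam) μ ν) - curlAt W X z μ ν‖ with hy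
  set D : ℝ := ‖Ad (W z lam) (((hol (vary W X 1) (z + e lam) (plaqWord μ ν) * (hol W (z + e lam) (plaqWord μ ν))⁻¹ : (Matrix n n ℂ)ˣ) : Matrix n n ℂ) - 1)
            - ((((hol (vary W X 1) z (plaqWord μ ν) * (hol W z (plaqWord μ ν))⁻¹ : (Matrix n n ℂ)ˣ) : Matrix n n ℂ)) - 1)‖ with hD
  set ε₁ : ℝ := Real.exp α - 1 with hε₁
  set E : ℝ := Real.exp (4 * α) with hE
  set Q₁ : ℝ := 64 * α * (α₁ + 2 * ε₁ * α) + 960 * x * α ^ 2 + 64 * ε₁ * α ^ 2 with hQ₁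
  set Γ : ℝ := y + Q₁ + 8 * α * ε₁ with hΓ
  set G : ℝ := (x₁ + 2 * α * x + Γ) * E + 2 * ε₁ * x with hG
  have hy0 : 0 ≤ y := norm_nonneg _
  have hD0 : 0 ≤ D := norm_nonneg _
  have hε₁0 : 0 ≤ ε₁ := by rw [hε₁]; linarith [Real.add_one_le_exp α]
  have hε₁2 : ε₁ ≤ 2 * α := exp_sub_one_le_two_mul hα0 (by linarith)
  have hE0 : 0 ≤ E := (Real.exp_pos _).le
  have hE2 : E ≤ 2 := exp_four_mul_le_two (by linarith)
  clear_value y D ε₁ E Q₁ Γ G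
  have hmain' : y ≤ D + (Q₁ + 24 * α * ε₁ * G + y * (4 * α + 24 * α * ε₁) + 4 * α * (G + x₁)) + (8 * α + 24 * α * ε₁) * x₁ := hmain
  -- nonnegativity of the letters and monomials
  have hαα : 0 ≤ α * α := mul_nonneg hα0 hα0
  have hα3 : 0 ≤ α ^ 3 := pow_nonneg hα0 3
  have hαα₁ : 0 ≤ α * α₁ := mul_nonneg hα0 hα₁0
  have hαx₁ : 0 ≤ α * x₁ := mul_nonneg hα0 hx₁0
  have hααx : 0 ≤ α ^ 2 * x := mul_nonneg (sq_nonneg α) hx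
  have hαε : 0 ≤ α * ε₁ := mul_nonneg hα0 hε₁0
  have hQ₁0 : 0 ≤ Q₁ := by
    rw [hQ₁]
    have : 0 ≤ 64 * α * (α₁ + 2 * ε₁ * α) := mul_nonneg (by positivity) (by nlinarith)
    nlinarith
  have hΓ0 : 0 ≤ Γ := by rw [hΓ]; nlinarith
  have hG0 : 0 ≤ G := by
    rw [hG]
    have h1 : 0 ≤ (x₁ + 2 * α * x + Γ) * E := mul_nonneg (by nlinarith) hE0
    nlinarith
  have h24 : 24 * ε₁ ≤ 1 := by linarith
  -- `Q₁ ≤ Q₁' := 64αα₁ + 960α²x + 384α³`, `Γ ≤ y + Q₁' + 16α²`, `G ≤ 2x₁ + 8αx + 2y + 2Q₁' + 32α²`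
  have p1 : α ^ 2 * ε₁ ≤ α ^ 2 * (2 * α) := mul_le_mul_of_nonneg_left hε₁2 (sq_nonneg α)
  have p2 : α * ε₁ ≤ α * (2 * α) := mul_le_mul_of_nonneg_left hε₁2 hα0
  have hQQ : Q₁ ≤ 64 * α * α₁ + 960 * α ^ 2 * x + 384 * α ^ 3 := by rw [hQ₁]; linarith
  have hΓle : Γ ≤ y + (64 * α * α₁ + 960 * α ^ 2 * x + 384 * α ^ 3) + 16 * α ^ 2 := by rw [hΓ]; linarith
  have p3 : (x₁ + 2 * α * x + Γ) * E ≤ (x₁ + 2 * α * x + Γ) * 2 := mul_le_mul_of_nonneg_left hE2 (by nlinarith)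
  have p4 : ε₁ * x ≤ (2 * α) * x := mul_le_mul_of_nonneg_right hε₁2 hx
  have hGle : G ≤ 2 * x₁ + 8 * α * x + 2 * y + 2 * (64 * α * α₁ + 960 * α ^ 2 * x + 384 * α ^ 3) + 32 * α ^ 2 := by
    rw [hG]; linarith
  -- the product facts feeding the absorption
  have p5 : G * α * (24 * ε₁) ≤ G * α * 1 := mul_le_mul_of_nonneg_left h24 (mul_nonneg hG0 hα0)
  have p6 : α * G ≤ α * (2 * x₁ + 8 * α * x + 2 * y + 2 * (64 * α * α₁ + 960 * α ^ 2 * x + 384 * α ^ 3) + 32 * α ^ 2) :=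
    mul_le_mul_of_nonneg_left hGle hα0
  have p7 : y * α * (24 * ε₁) ≤ y * α * 1 := mul_le_mul_of_nonneg_left h24 (mul_nonneg hy0 hα0)
  have p8 : x₁ * α * (24 * ε₁) ≤ x₁ * α * 1 := mul_le_mul_of_nonneg_left h24 (mul_nonneg hx₁0 hα0)
  have p9 : α * (α * α₁) ≤ (1 / 48) * (α * α₁) := mul_le_mul_of_nonneg_right hα hαα₁
  have p9' : α * (α ^ 2 * x) ≤ (1 / 48) * (α ^ 2 * x) := mul_le_mul_of_nonneg_right hα hααx
  have p9'' : α * α ^ 3 ≤ (1 / 48) * α ^ 3 := mul_le_mul_of_nonneg_right hα hα3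
  have p10 : α * y ≤ (1 / 48) * y := mul_le_mul_of_nonneg_right hα hy0
  linarith [hmain', p5, p6, p7, p8, p9, p9', p9'', p10, hQQ, hD0, hαα₁, hαx₁, hααx, hα3]

/-! ## §4 The headline: the curl's gradient from the radii of the two configurations -/

/-- **STUB (S-b): THE COVARIANT GRADIENT OF THE DRESSED CURL FROM THE PLAQUETTE(-GRADIENT) RADII OF THE PAIR.**  `W` unitary, `X` skew with
`‖X‖ ≤ α ≤ 1∕48` and forward covariant gradient letter `α₁`; `U′ = We^{X}`; `SmallField W x_W`, `SmallField U′ x_U` (`x_W, x_U ≥ 0`); at the bond `(p, λ)`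
(`p = (z; μ, ν)`, `μ ≠ ν`, `p′ = p + e_λ`) the plaquette-gradient radii `x₁W ≥ ‖Ad_{W(z,λ)}W(∂p′) − W(∂p)‖`, `x₁U ≥ ‖Ad_{U′(z,λ)}U′(∂p′) − U′(∂p)‖`.  THEN
`‖Ad_{W(z,λ)} (d_W X)(p′) − (d_W X)(p)‖ ≤ 2x₁U + 3x₁W + 8α·x_U + 128α·α₁ + 2048α²(x_W + x_U) + 1330α³`. [folklore] -/
theorem norm_curlGrad_le_of_radii [Nonempty n] {W : Site d → Fin d → (Matrix n n ℂ)ˣ} (hW : IsUnitaryCfg W)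
    {X : Site d → Fin d → Matrix n n ℂ} (hX : IsSkewDir X) {α α₁ xW xU x₁W x₁U : ℝ} (hXα : ∀ x κ, ‖X x κ‖ ≤ α) (hα : α ≤ 1 / 48)
    (hX1 : ∀ (y : Site d) (κ τ : Fin d), ‖Ad (W (y + e κ) τ) (X (y + e τ) κ) - X y κ‖ ≤ α₁) (hxW : 0 ≤ xW) (hxU : 0 ≤ xU)
    (hWx : SmallField W xW) (hUx : SmallField (vary W X 1) xU) (z : Site d) (lam : Fin d) {μ ν : Fin d} (hμν : μ ≠ ν)
    (hx₁W : ‖Ad (W z lam) ((hol W (z + e lam) (plaqWord μ ν) : (Matrix n n ℂ)ˣ) : Matrix n n ℂ) - ((hol W z (plaqWord μ ν) : (Matrix n n ℂ)ˣ) : Matrix n n ℂ)‖ ≤ x₁W)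
    (hx₁U : ‖Ad (vary W X 1 z lam) ((hol (vary W X 1) (z + e lam) (plaqWord μ ν) : (Matrix n n ℂ)ˣ) : Matrix n n ℂ)
        - ((hol (vary W X 1) z (plaqWord μ ν) : (Matrix n n ℂ)ˣ) : Matrix n n ℂ)‖ ≤ x₁U) :
    ‖Ad (W z lam) (curlAt W X (z + e lam) μ ν) - curlAt W X z μ ν‖
      ≤ 2 * x₁U + 3 * x₁W + 8 * α * xU + 128 * α * α₁ + 2048 * α ^ 2 * (xW + xU) + 1330 * α ^ 3 := by
  have hα0 : 0 ≤ α := (norm_nonneg _).trans (hXα z lam)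
  -- the segment's small-field radius
  set x : ℝ := max xW xU + 7 * α ^ 2 with hx
  have hx0 : 0 ≤ x := by rw [hx]; positivity
  have hxs : ∀ s ∈ Icc (0 : ℝ) 1, SmallField (vary W X s) x := fun s hs => smallField_vary_segment_max hW hX hWx hUx hXα hs
  have hpoly := norm_curl_covDiff_le_poly hW hX hXα hα hX1 hx0 hxs z lam hμν hx₁W
  -- the quotient's gradient ((S-b)₁)
  have hxU' : ‖((hol (vary W X 1) (z + e lam) (plaqWord μ ν) : (Matrix n n ℂ)ˣ) : Matrix n n ℂ) - 1‖ ≤ xU := hUx (z + e lam) μ ν hμν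
  have hD := norm_plaqQuot_covDiff_le hW hX hXα z lam μ ν hxU' hx₁U hx₁W
  have hε₁2 : Real.exp α - 1 ≤ 2 * α := exp_sub_one_le_two_mul hα0 (by linarith)
  have hmax : max xW xU ≤ xW + xU := max_le (by linarith) (by linarith)
  have hα3 : 0 ≤ α ^ 3 := pow_nonneg hα0 3
  have p1 : (Real.exp α - 1) * xU ≤ (2 * α) * xU := mul_le_mul_of_nonneg_right hε₁2 hxU
  have p2 : α ^ 2 * max xW xU ≤ α ^ 2 * (xW + xU) := mul_le_mul_of_nonneg_left hmax (sq_nonneg α)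
  have p2' : α ^ 2 * x = α ^ 2 * max xW xU + 7 * α ^ 4 := by rw [hx]; ring
  have p3 : α * α ^ 3 ≤ (1 / 48) * α ^ 3 := mul_le_mul_of_nonneg_right hα hα3
  have p4 : α * x₁W ≤ (1 / 48) * x₁W := mul_le_mul_of_nonneg_right hα ((norm_nonneg _).trans hx₁W)
  clear_value x
  linarith [hpoly, hD, p1, p2, p2', p3, p4, hα3]

/-- **THE SAME IN THE TREE'S CURRENCY** (`ξ = (L^k)⁻¹ ≤ 1`; the rate claim of ROAD-G106 §4 «`B′ = O(εξ³)`»): with `x₁U ≤ 2c_A·ξ³`, `x₁W ≤ 2c_W·ξ³`,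
`x_U, x_W ≤ b·ξ²` (`b ≥ 0`), `α ≤ C_Sε·ξ` (`0 ≤ C_Sε ≤ 1∕48`), `α₁ ≤ a₁·ξ²`:
`‖Ad_{W(z,λ)} (d_W X)(p′) − (d_W X)(p)‖ ≤ (4c_A + 6c_W + C_Sε·(8b + 128a₁ + 4096·C_Sε·b + 1330·C_Sε²))·ξ³`. [folklore] -/
theorem norm_curlGrad_le_scaled [Nonempty n] {W : Site d → Fin d → (Matrix n n ℂ)ˣ} (hW : IsUnitaryCfg W)
    {X : Site d → Fin d → Matrix n n ℂ} (hX : IsSkewDir X) {α α₁ xW xU x₁W x₁U ξ cA cW b CSε a₁ : ℝ} (hXα : ∀ x κ, ‖X x κ‖ ≤ α)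
    (hX1 : ∀ (y : Site d) (κ τ : Fin d), ‖Ad (W (y + e κ) τ) (X (y + e τ) κ) - X y κ‖ ≤ α₁) (hxW : 0 ≤ xW) (hxU : 0 ≤ xU)
    (hWx : SmallField W xW) (hUx : SmallField (vary W X 1) xU) (z : Site d) (lam : Fin d) {μ ν : Fin d} (hμν : μ ≠ ν)
    (hx₁W : ‖Ad (W z lam) ((hol W (z + e lam) (plaqWord μ ν) : (Matrix n n ℂ)ˣ) : Matrix n n ℂ) - ((hol W z (plaqWord μ ν) : (Matrix n n ℂ)ˣ) : Matrix n n ℂ)‖ ≤ x₁W)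
    (hx₁U : ‖Ad (vary W X 1 z lam) ((hol (vary W X 1) (z + e lam) (plaqWord μ ν) : (Matrix n n ℂ)ˣ) : Matrix n n ℂ)
        - ((hol (vary W X 1) z (plaqWord μ ν) : (Matrix n n ℂ)ˣ) : Matrix n n ℂ)‖ ≤ x₁U)
    (hξ0 : 0 ≤ ξ) (hξ1 : ξ ≤ 1) (hb : 0 ≤ b) (hCS0 : 0 ≤ CSε) (hCS : CSε ≤ 1 / 48)
    (hx₁Ule : x₁U ≤ 2 * cA * ξ ^ 3) (hx₁Wle : x₁W ≤ 2 * cW * ξ ^ 3) (hxUle : xU ≤ b * ξ ^ 2) (hxWle : xW ≤ b * ξ ^ 2)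
    (hαle : α ≤ CSε * ξ) (hα₁le : α₁ ≤ a₁ * ξ ^ 2) :
    ‖Ad (W z lam) (curlAt W X (z + e lam) μ ν) - curlAt W X z μ ν‖
      ≤ (4 * cA + 6 * cW + CSε * (8 * b + 128 * a₁ + 4096 * CSε * b + 1330 * CSε ^ 2)) * ξ ^ 3 := by
  have hα0 : 0 ≤ α := (norm_nonneg _).trans (hXα z lam)
  have hα : α ≤ 1 / 48 := hαle.trans (by nlinarith)
  have h := norm_curlGrad_le_of_radii hW hX hXα hα hX1 hxW hxU hWx hUx z lam hμν hx₁W hx₁U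
  have hα₁0 : 0 ≤ α₁ := (norm_nonneg _).trans (hX1 z lam lam)
  have hCξ : 0 ≤ CSε * ξ := mul_nonneg hCS0 hξ0
  -- every term at the rate `ξ³`
  have t1 : α * xU ≤ (CSε * ξ) * (b * ξ ^ 2) := mul_le_mul hαle hxUle hxU hCξ
  have t2 : α * α₁ ≤ (CSε * ξ) * (a₁ * ξ ^ 2) := mul_le_mul hαle hα₁le hα₁0 hCξ
  have hα2 : α ^ 2 ≤ (CSε * ξ) ^ 2 := pow_le_pow_left₀ hα0 hαle 2
  have hα3 : α ^ 3 ≤ (CSε * ξ) ^ 3 := pow_le_pow_left₀ hα0 hαle 3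
  have t3 : α ^ 2 * (xW + xU) ≤ (CSε * ξ) ^ 2 * (2 * b * ξ ^ 2) :=
    mul_le_mul hα2 (by linarith) (by linarith) (sq_nonneg _)
  have hξ4 : ξ ^ 4 ≤ ξ ^ 3 := by nlinarith [pow_nonneg hξ0 3]
  have u3 : CSε ^ 2 * b * ξ ^ 4 ≤ CSε ^ 2 * b * ξ ^ 3 := mul_le_mul_of_nonneg_left hξ4 (by positivity)
  linarith [h, t1, t2, t3, hα3, u3, hx₁Ule, hx₁Wle]

end

end Summit.QuantumFields.BalabanUV.T4Continuum.NE7CurlGradientReading
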